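import Mathlib.Analysis.SpecialFunctions.ExpDeriv
import Mathlib.Analysis.Calculus.MeanValue
import Mathlib.Topology.MetricSpace.Lipschitz
import HarnessLib

/-!
# Crux `FluctuationComparisonRegPrIntL` (stmt-QuantumFields-20520, rung R3), PATH-B organ — (L39a) LIPSCHITZ PRODUCT TOOLS ON `ℝ` (Mathlib-only; reusable by the T⁴ cells)

Cell `ym3-torus` (YM ladder rung R3 = continuum `SU(2)` Yang–Mills on the three-torus — a RUNG: NOT d = 4, NOT infinite volume, NOT a mass gap, NOT Clay).
Width seat `ym-ust-20520-w5` (gen 25), `--kind proof --supports stmt-QuantumFields-20520 --as helper`, count-neutral, DEFINITION-FREE, default heartbeats, Mathlib + HarnessLib only.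

WHAT ([folklore] Lipschitz algebra for real functions of one real variable, the tools of ✓(L39b) `…OrganTangentWeightLipOfChartLetters`):
★`lipschitzOnWith_mul_of_support` — PRODUCT RULE ON THE SUPPORT: `f` Lipschitz (`Kf`) and bounded (`Mf`) on `I`, `g` Lipschitz (`Kg`) and bounded (`Mg`) ONLY on `{s ∈ I | f s ≠ 0}`
⟹ `f·g` Lipschitz on `I` with modulus `Kf·Mg + Mf·Kg` (the shape in which a cut-off weight `χ·w` needs `w`'s regularity only where the cut lives); `lipschitzOnWith_mul_of_bound`
(both factors on `I`); ★`lipschitzOnWith_finset_prod` — a finite product of `[0,1]`-valued Lipschitz factors is Lipschitz with the SUM of the moduli; `lipschitzWith_ramp` — the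
soft cut's ramp `x ↦ max 0 (min 1 ((a − x)∕w))` (`w > 0`) is `1∕w`-Lipschitz, `ramp_mem_Icc` (`[0,1]`-valued);
`lipschitzOnWith_exp_Iic` — `exp` is `e^B`-Lipschitz on `(-∞, B]` (mean value inequality); `lipschitzOnWith_exp_of_le` — `exp ∘ L` is Lipschitz with modulus `e^B·K` where `L` is
`K`-Lipschitz and `≤ B`.

HONEST FRAMING: elementary real analysis, no physics; nothing of Bałaban's is asserted or proved; no hypothesis row is touched or discharged; the five registered stubs of
`Lines/semiclassical_s2beta.lean`, crux 20520 and `YM3TorusSU2` are NOT proved; rung R3 = SU(2) YM₃ on T³ — NOT d = 4, NOT infinite volume, NOT a mass gap, NOT Clay.  [folklore]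
-/

set_option autoImplicit false

noncomputable section

namespace Summit.QuantumFields.YangMills.Theorems.OrganTangentLipschitzProductTools

open Set
open scoped NNReal BigOperators

/-! ## §0 Folklore: Lipschitz products on the support, finite products of `[0,1]`-valued factors, the ramp, the exponential -/

section Folklore

/-- **PRODUCT RULE ON THE SUPPORT**: `f` Lipschitz (`Kf`) and bounded (`Mf`) on `I`, `g` Lipschitz (`Kg`) and bounded (`Mg`) on the SUPPORT `{s ∈ I | f s ≠ 0}` only ⟹ `f·g`
Lipschitz on `I` with modulus `Kf·Mg + Mf·Kg`. [folklore] -/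
theorem lipschitzOnWith_mul_of_support {Kf Kg : ℝ≥0} {Mf Mg : ℝ} {f g : ℝ → ℝ} {I : Set ℝ}
    (hf : LipschitzOnWith Kf f I) (hMf : ∀ s ∈ I, |f s| ≤ Mf)
    (hg : LipschitzOnWith Kg g {s | s ∈ I ∧ f s ≠ 0}) (hMg : ∀ s ∈ I, f s ≠ 0 → |g s| ≤ Mg) (hMf0 : 0 ≤ Mf) (hMg0 : 0 ≤ Mg) :
    LipschitzOnWith (Kf * Real.toNNReal Mg + Real.toNNReal Mf * Kg) (fun s => f s * g s) I := by
  rw [lipschitzOnWith_iff_dist_le_mul] at hf hg ⊢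
  intro x hx y hy
  have hK : ((Kf * Real.toNNReal Mg + Real.toNNReal Mf * Kg : ℝ≥0) : ℝ) = Kf * Mg + Mf * Kg := by
    simp [Real.coe_toNNReal _ hMf0, Real.coe_toNNReal _ hMg0]
  rw [hK, Real.dist_eq]
  have hdist : 0 ≤ dist x y := dist_nonneg
  have hKg0 : 0 ≤ Mf * Kg * dist x y := by positivity
  by_cases hfx : f x = 0
  · by_cases hfy : f y = 0
    · rw [hfx, hfy]; simp only [zero_mul, sub_self, abs_zero]; positivity
    · have h1 := hf x hx y hy
      rw [Real.dist_eq] at h1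
      have e : |f x * g x - f y * g y| = |f x - f y| * |g y| := by rw [hfx, zero_mul, zero_sub, abs_neg, abs_mul, zero_sub, abs_neg]
      rw [e]
      calc |f x - f y| * |g y| ≤ (Kf * dist x y) * Mg := mul_le_mul h1 (hMg y hy hfy) (abs_nonneg _) (by positivity)
        _ ≤ (Kf * Mg + Mf * Kg) * dist x y := by nlinarith
  · by_cases hfy : f y = 0
    · have h1 := hf x hx y hy
      rw [Real.dist_eq] at h1
      have e : |f x * g x - f y * g y| = |f x - f y| * |g x| := by rw [hfy, zero_mul, sub_zero, abs_mul, sub_zero]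
      rw [e]
      calc |f x - f y| * |g x| ≤ (Kf * dist x y) * Mg := mul_le_mul h1 (hMg x hx hfx) (abs_nonneg _) (by positivity)
        _ ≤ (Kf * Mg + Mf * Kg) * dist x y := by nlinarith
    · have h1 := hf x hx y hy
      have h2 := hg x ⟨hx, hfx⟩ y ⟨hy, hfy⟩
      rw [Real.dist_eq] at h1 h2
      have e : f x * g x - f y * g y = (f x - f y) * g x + f y * (g x - g y) := by ring
      rw [e]
      calc |(f x - f y) * g x + f y * (g x - g y)| ≤ |f x - f y| * |g x| + |f y| * |g x - g y| := by
            refine (abs_add_le _ _).trans ?_; rw [abs_mul, abs_mul]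
        _ ≤ (Kf * dist x y) * Mg + Mf * (Kg * dist x y) :=
            add_le_add (mul_le_mul h1 (hMg x hx hfx) (abs_nonneg _) (by positivity)) (mul_le_mul (hMf y hy) h2 (abs_nonneg _) hMf0)
        _ = (Kf * Mg + Mf * Kg) * dist x y := by ring

/-- The plain product rule: both factors Lipschitz and bounded on `I`. [folklore] -/
theorem lipschitzOnWith_mul_of_bound {Kf Kg : ℝ≥0} {Mf Mg : ℝ} {f g : ℝ → ℝ} {I : Set ℝ}
    (hf : LipschitzOnWith Kf f I) (hMf : ∀ s ∈ I, |f s| ≤ Mf) (hg : LipschitzOnWith Kg g I) (hMg : ∀ s ∈ I, |g s| ≤ Mg) (hMf0 : 0 ≤ Mf) (hMg0 : 0 ≤ Mg) :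
    LipschitzOnWith (Kf * Real.toNNReal Mg + Real.toNNReal Mf * Kg) (fun s => f s * g s) I :=
  lipschitzOnWith_mul_of_support hf hMf (hg.mono fun _ hs => hs.1) (fun s hs _ => hMg s hs) hMf0 hMg0

/-- **FINITE PRODUCTS OF `[0,1]`-VALUED LIPSCHITZ FACTORS** are Lipschitz with the SUM of the moduli. [folklore] -/
theorem lipschitzOnWith_finset_prod {ι : Type*} (T : Finset ι) {u : ι → ℝ → ℝ} {K : ι → ℝ≥0} {I : Set ℝ}
    (h01 : ∀ i ∈ T, ∀ s ∈ I, u i s ∈ Icc (0:ℝ) 1) (hL : ∀ i ∈ T, LipschitzOnWith (K i) (u i) I) :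
    LipschitzOnWith (∑ i ∈ T, K i) (fun s => ∏ i ∈ T, u i s) I := by
  classical
  induction T using Finset.induction_on with
  | empty => simp only [Finset.sum_empty, Finset.prod_empty]; exact (LipschitzWith.const (1:ℝ)).lipschitzOnWith
  | @insert a T ha ih =>
    have h01' : ∀ i ∈ T, ∀ s ∈ I, u i s ∈ Icc (0:ℝ) 1 := fun i hi => h01 i (Finset.mem_insert_of_mem hi)
    have hL' : ∀ i ∈ T, LipschitzOnWith (K i) (u i) I := fun i hi => hL i (Finset.mem_insert_of_mem hi)
    have ihT := ih h01' hL'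
    have ha01 := h01 a (Finset.mem_insert_self a T)
    have hprod01 : ∀ s ∈ I, |∏ i ∈ T, u i s| ≤ 1 := by
      intro s hs
      rw [abs_of_nonneg (Finset.prod_nonneg fun i hi => (h01' i hi s hs).1)]
      exact Finset.prod_le_one (fun i hi => (h01' i hi s hs).1) (fun i hi => (h01' i hi s hs).2)
    have key := lipschitzOnWith_mul_of_bound (hL a (Finset.mem_insert_self a T)) (Mf := 1) (Mg := 1)
      (fun s hs => by rw [abs_of_nonneg (ha01 s hs).1]; exact (ha01 s hs).2) ihT hprod01 zero_le_one zero_le_one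
    simp only [Real.toNNReal_one, mul_one, one_mul] at key
    simpa only [Finset.prod_insert ha, Finset.sum_insert ha] using key

/-- **THE RAMP** `x ↦ max 0 (min 1 ((a − x)∕w))` (`w > 0`) is `(1∕w)`-Lipschitz and `[0,1]`-valued. [folklore] -/
theorem lipschitzWith_ramp {a w : ℝ} (hw : 0 < w) :
    LipschitzWith (Real.toNNReal (1 / w)) (fun x : ℝ => max 0 (min 1 ((a - x) / w))) := by
  have h1 : LipschitzWith (Real.toNNReal (1 / w)) (fun x : ℝ => (a - x) / w) := by
    apply LipschitzWith.of_dist_le_mul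
    intro x y
    rw [Real.dist_eq, Real.dist_eq, Real.coe_toNNReal _ (by positivity), ← sub_div, abs_div, abs_of_pos hw]
    rw [show a - x - (a - y) = -(x - y) by ring, abs_neg, div_eq_inv_mul, one_div]
  exact (LipschitzWith.const_min h1 1).const_max 0

/-- The ramp takes values in `[0,1]`. [folklore] -/
theorem ramp_mem_Icc (a w x : ℝ) : max 0 (min 1 ((a - x) / w)) ∈ Icc (0:ℝ) 1 :=
  ⟨le_max_left _ _, max_le zero_le_one (min_le_left _ _)⟩

/-- `exp` is Lipschitz on `(-∞, B]` with modulus `e^B` (mean value inequality). [folklore] -/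
theorem lipschitzOnWith_exp_Iic (B : ℝ) : LipschitzOnWith (Real.toNNReal (Real.exp B)) Real.exp (Set.Iic B) := by
  refine (convex_Iic B).lipschitzOnWith_of_nnnorm_hasDerivWithin_le (f := Real.exp) (f' := Real.exp)
    (fun x _ => (Real.hasDerivAt_exp x).hasDerivWithinAt) fun x hx => ?_
  rw [← NNReal.coe_le_coe, coe_nnnorm, Real.norm_eq_abs, abs_of_pos (Real.exp_pos x), Real.coe_toNNReal _ (Real.exp_pos B).le]
  exact Real.exp_le_exp.2 hx

/-- **EXPONENTIAL OF A LIPSCHITZ EXPONENT BOUNDED ABOVE**: `L` Lipschitz (`K`) on `S` with `L ≤ B` on `S` ⟹ `exp ∘ L` Lipschitz on `S` with modulus `e^B·K`. [folklore] -/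
theorem lipschitzOnWith_exp_of_le {K : ℝ≥0} {B : ℝ} {L : ℝ → ℝ} {S : Set ℝ}
    (hL : LipschitzOnWith K L S) (hB : ∀ s ∈ S, L s ≤ B) :
    LipschitzOnWith (Real.toNNReal (Real.exp B) * K) (fun s => Real.exp (L s)) S :=
  (lipschitzOnWith_exp_Iic B).comp hL fun s hs => hB s hs

end Folklore


/-! ## §1 (v1.1, append-only; width seat `ym-ust-20520-w5` g25, for ✓(L42) the SEGMENT EDITION of the (I-law) REG′ reduction) The product rule with the second factor
controlled only ALONG IN-SUPPORT SEGMENTS of a convex parameter set -/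

section Segment

/-- ★ **PRODUCT RULE ON THE SUPPORT, SEGMENT EDITION**: on a CONVEX real set `I`, `f` Lipschitz (`Kf`) and bounded (`Mf`) on `I`, `g` bounded (`Mg`) on the support of `f` and
Lipschitz (`Kg`) only between support points JOINED BY AN IN-SUPPORT SEGMENT (`∀ r ∈ uIcc x y, f r ≠ 0`) ⟹ `f·g` Lipschitz on `I` with modulus `Kf·Mg + Mf·Kg`.  (Between two
support points not so joined sits a zero `r` of `f`, and `|f x·g x − f y·g y| ≤ |f x − f r|·|g x| + |f r − f y|·|g y| ≤ Kf·Mg·|x − y|`.) [folklore] -/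
theorem lipschitzOnWith_mul_of_support_seg {Kf Kg : ℝ≥0} {Mf Mg : ℝ} {f g : ℝ → ℝ} {I : Set ℝ} (hI : Convex ℝ I)
    (hf : LipschitzOnWith Kf f I) (hMf : ∀ s ∈ I, |f s| ≤ Mf)
    (hg : ∀ x ∈ I, ∀ y ∈ I, (∀ r ∈ Set.uIcc x y, f r ≠ 0) → |g x - g y| ≤ Kg * |x - y|)
    (hMg : ∀ s ∈ I, f s ≠ 0 → |g s| ≤ Mg) (hMf0 : 0 ≤ Mf) (hMg0 : 0 ≤ Mg) :
    LipschitzOnWith (Kf * Real.toNNReal Mg + Real.toNNReal Mf * Kg) (fun s => f s * g s) I := by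
  rw [lipschitzOnWith_iff_dist_le_mul] at hf ⊢
  intro x hx y hy
  have hK : ((Kf * Real.toNNReal Mg + Real.toNNReal Mf * Kg : ℝ≥0) : ℝ) = Kf * Mg + Mf * Kg := by
    simp [Real.coe_toNNReal _ hMf0, Real.coe_toNNReal _ hMg0]
  rw [hK, Real.dist_eq]
  have hdist : 0 ≤ dist x y := dist_nonneg
  have hKg0 : 0 ≤ Mf * Kg * dist x y := by positivity
  have hfx' := hf x hx y hy
  rw [Real.dist_eq] at hfx'
  by_cases hfx : f x = 0
  · by_cases hfy : f y = 0
    · rw [hfx, hfy]; simp only [zero_mul, sub_self, abs_zero]; positivity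
    · have e : |f x * g x - f y * g y| = |f x - f y| * |g y| := by rw [hfx, zero_mul, zero_sub, abs_neg, abs_mul, zero_sub, abs_neg]
      rw [e]
      calc |f x - f y| * |g y| ≤ (Kf * dist x y) * Mg := mul_le_mul hfx' (hMg y hy hfy) (abs_nonneg _) (by positivity)
        _ ≤ (Kf * Mg + Mf * Kg) * dist x y := by nlinarith
  · by_cases hfy : f y = 0
    · have e : |f x * g x - f y * g y| = |f x - f y| * |g x| := by rw [hfy, zero_mul, sub_zero, abs_mul, sub_zero]
      rw [e]
      calc |f x - f y| * |g x| ≤ (Kf * dist x y) * Mg := mul_le_mul hfx' (hMg x hx hfx) (abs_nonneg _) (by positivity)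
        _ ≤ (Kf * Mg + Mf * Kg) * dist x y := by nlinarith
    · by_cases hseg : ∀ r ∈ Set.uIcc x y, f r ≠ 0
      · have h2 := hg x hx y hy hseg
        rw [← Real.dist_eq x y] at h2
        have e : f x * g x - f y * g y = (f x - f y) * g x + f y * (g x - g y) := by ring
        rw [e]
        calc |(f x - f y) * g x + f y * (g x - g y)| ≤ |f x - f y| * |g x| + |f y| * |g x - g y| := by
              refine (abs_add_le _ _).trans ?_; rw [abs_mul, abs_mul]
          _ ≤ (Kf * dist x y) * Mg + Mf * (Kg * dist x y) :=
              add_le_add (mul_le_mul hfx' (hMg x hx hfx) (abs_nonneg _) (by positivity)) (mul_le_mul (hMf y hy) h2 (abs_nonneg _) hMf0)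
          _ = (Kf * Mg + Mf * Kg) * dist x y := by ring
      · -- a zero `r` of `f` on the segment: split there
        push Not at hseg
        obtain ⟨r, hr, hfr⟩ := hseg
        have hrI : r ∈ I := hI.ordConnected.uIcc_subset hx hy hr
        have h1 := hf x hx r hrI
        have h3 := hf r hrI y hy
        rw [Real.dist_eq] at h1 h3
        have hsplit : dist x r + dist r y = dist x y := by
          rw [Real.dist_eq, Real.dist_eq, Real.dist_eq]
          rcases Set.mem_uIcc.1 hr with ⟨h₁, h₂⟩ | ⟨h₁, h₂⟩
          · rw [abs_of_nonpos (sub_nonpos.2 h₁), abs_of_nonpos (sub_nonpos.2 h₂), abs_of_nonpos (sub_nonpos.2 (h₁.trans h₂))]; ring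
          · rw [abs_of_nonneg (sub_nonneg.2 h₂), abs_of_nonneg (sub_nonneg.2 h₁), abs_of_nonneg (sub_nonneg.2 (h₁.trans h₂))]; ring
        have e : f x * g x - f y * g y = (f x - f r) * g x + (f r - f y) * g y := by rw [hfr]; ring
        rw [e]
        calc |(f x - f r) * g x + (f r - f y) * g y| ≤ |f x - f r| * |g x| + |f r - f y| * |g y| := by
              refine (abs_add_le _ _).trans ?_; rw [abs_mul, abs_mul]
          _ ≤ (Kf * dist x r) * Mg + (Kf * dist r y) * Mg :=
              add_le_add (mul_le_mul h1 (hMg x hx hfx) (abs_nonneg _) (by positivity)) (mul_le_mul h3 (hMg y hy hfy) (abs_nonneg _) (by positivity))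
          _ = Kf * Mg * dist x y := by rw [← hsplit]; ring
          _ ≤ (Kf * Mg + Mf * Kg) * dist x y := by nlinarith

end Segment

end Summit.QuantumFields.YangMills.Theorems.OrganTangentLipschitzProductTools

end
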